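import Summits.QuantumFields.BalabanUV.Beta.GAN24.StripAliasWeights

/-!
# `BalabanUV.Beta.GAN24.StripLegVectors` — binder row G-an2-4 / (CONV-C), road P1-fibre, row **P1-L10** `FibreStrip` ((I3′)), cut «(M4) scaled alias-space
# Neumann, two anchors» (`HOME/b2b-balaban-gan24-formalise-leaf-16/L10-CUT-M4.md`), module **F8 part 1**: the LEG VECTORS ON THE STRIP —
# `N`-uniform `ℓ²`-over-aliases bounds of the M-level reading / source weights of `GAN24/AliasObjects` at a COMPLEX coarse momentum

NOT IN PRINT; OUR PROOF ATTEMPT (of the road; THIS file is [folklore] trigonometric bookkeeping over `ℂ`).  HONEST FRAMING (cell contract, verbatim):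
«discharging `BetaPertH` makes Bałaban's UV stability UNCONDITIONAL — a real constructive-QFT result; it is NOT the continuum limit and NOT the Clay
problem.»  HONEST DEPENDENCY (verbatim): «continuum YM on T⁴ ⇐ BetaPertH ∧ nine spine estimates (0/9 proved); BetaPertH ⇐ (D1) ∧ (D4) ∧ CAP+tail;
G-an2-4 gates asym, D1 and NE2/3/4.»  No cited fact, no wall binder, no `def … : Prop`; nothing of the K-slot of (CONV-C) is discharged here.  NOT summit progress.

## Why (F8 = (U2) of the cut: the sup bound of `kFibΔ_j` on `Strip (d+1) κ`, `j`-uniform)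
By `KFibClosedForm.kFibW_eq_readout` + `FibreDFTDictionary.boxData_inl_eq_sum` the leg function `kFibW` at ANY complex `p` is a PAIRING of an M-level
READING vector (the weights `readW` of `GAN24/AliasObjects` on the alias amplitudes `Â_κ(m)`, resp. a unit vector on `φ_κ`) with the arrow solution of an
M-level SOURCE vector (`srcW` on the EL rows, resp. a unit vector on a Q row).  F7 of the cut delivers an a-priori bound of the SCALED arrow inverse; the
scaled Cauchy–Schwarz inequality (part 2, `StripLegReadout`) then needs exactly the two numbers bounded HERE, uniformly in `N` on the strip
`|Im p_i| ≤ η ≤ 1/4`, `|Re p_i| ≤ π`: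
* §1 TERMWISE: `‖readW N M p m κ ρ‖² ≤ e^{2ηΣ|ρ_i|} · 6^{D+1} · ((N/M)²)^D · Π_i wMaj N (m i)` and the same bound for `‖N^D · srcW N M p m κ ρ‖²`
  (leaf-18's strip majorants `StripAliasWeights.norm_SMAl_sq_le_strip` / `norm_sMAl_sq_le_strip` (‖gs‖² ≤ 6n²·sinWt) and `norm_cexp_offset_le`,
  leaf-17's change of box `AliasWeights.sinWt_le_sq_mul_sinWt` and Jordan majorant `sinWt_kfine_le_wMaj`, BY NAME);
* §2 SUMMED OVER THE ALIASES: `Σ_m ‖readW …‖² ≤ e^{2ηΣ|ρ_i|} · 6^{D+1} · ((N/M)²)^D · 5^D` (leaf-17's `AliasWeightsSum.sum_prod_wMaj_le`), and the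
  ROW-WEIGHTED source sum `Σ_m (w m)² ‖N^D srcW …‖² ≤ e^{2ηΣ|ρ_i|} · 6^{D+1} · ((N/M)²)^D · ((w 0)² + W²(5^D − 1))` for any row weights with
  `0 ≤ w m ≤ W` off the zero alias (in the cut: `w m = N²/r_m²`, `r_m ≥ π` for `m ≠ 0`, `w 0 = N²/r₀²`).
All constants are displayed; `N` enters only through `N/M` (= `Lc` in the application) and the row weights.  The `e^{ηΣ|ρ_i|}` growth in the leg offset `ρ`
is harmless because (U2) is proved at box representatives `ρ = repZ z`, `0 ≤ ρ_i < Lc` (leaf-01's `FibreStepResidues.kFibΔ_eq_repZ`) — part 2.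
Unit `b2b-balaban-gan24-p1` (row G-an2-4 owner, gen 2), 2026-08-20.
-/

noncomputable section

open Complex Finset
open scoped BigOperators Real
open Literature.Probability.LatticeModels (TorusSite)
open Literature.MathematicalPhysics.QuantumFieldTheory
open Literature.MathematicalPhysics.QuantumFieldTheory.Balaban1983to89
open B4Strip (reVec)
open Summit.QuantumFields.BalabanUV.Beta.GAN24.AliasWeights
  (sinWt sinWt_pos sinWt_le_one kfine wMaj wMaj_nonneg wMaj_zero sinWt_kfine_le_wMaj sinWt_le_sq_mul_sinWt)
open Summit.QuantumFields.BalabanUV.Beta.GAN24.AliasWeightsSum (sum_prod_wMaj_le)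
open Summit.QuantumFields.BalabanUV.Beta.GAN24.AliasObjects (kAl readW srcW sMAl SMAl sbMAl SbMAl)
open Summit.QuantumFields.BalabanUV.Beta.GAN24.StripAliasWeights
  (norm_sMAl_sq_le_strip norm_SMAl_sq_le_strip norm_sbMAl_sq_le_strip norm_SbMAl_sq_le_strip norm_cexp_offset_le norm_cexp_neg_offset_le)

namespace Summit.QuantumFields.BalabanUV.Beta.GAN24.StripLegVectors

variable {D : ℕ} {N : ℕ} [NeZero N]

/-! ## §1 Termwise strip bounds of the reading / source weights -/

section Termwise

variable {p : Fin D → ℂ} {η : ℝ}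

omit [NeZero N] in
/-- [folklore] The alias weight majorant of the cut `Θ(m) := Π_i wMaj N (m i)` (`= 1` on the zero alias) is nonnegative. -/
theorem prod_wMaj_nonneg (m : TorusSite D N) : 0 ≤ ∏ i, wMaj N (m i) :=
  Finset.prod_nonneg fun i _ => wMaj_nonneg N (m i)

/-- [folklore] CHANGE OF BOX + JORDAN on the strip: `Π_i sinWt M x_i ≤ ((N/M)²)^D · Π_i wMaj N (m i)` at the fine momenta `x = kfine N (Re p) m`
(`0 < M ≤ N`, `|Re p_i| ≤ π`). -/
theorem prod_sinWt_le_wMaj (hre : ∀ i, |(p i).re| ≤ π) {M : ℕ} (hM : 0 < M) (hMN : M ≤ N) (m : TorusSite D N) :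
    ∏ i, sinWt M (kfine N (reVec p) m i) ≤ (((N : ℝ) / M) ^ 2) ^ D * ∏ i, wMaj N (m i) := by
  have hp : ∀ i, |reVec p i| ≤ π := hre
  calc ∏ i, sinWt M (kfine N (reVec p) m i)
      ≤ ∏ i, (((N : ℝ) / M) ^ 2 * wMaj N (m i)) :=
        Finset.prod_le_prod (fun i _ => (sinWt_pos _ _).le) fun i _ =>
          (sinWt_le_sq_mul_sinWt hM hMN _).trans (mul_le_mul_of_nonneg_left (sinWt_kfine_le_wMaj hp m i) (by positivity))
    _ = (((N : ℝ) / M) ^ 2) ^ D * ∏ i, wMaj N (m i) := by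
        rw [Finset.prod_mul_distrib, Finset.prod_const, Finset.card_univ, Fintype.card_fin]

/-- [folklore] The leg-offset growth factor `e(ρ) = exp(η·Σ_i |ρ_i|)` is `≥ 1`… in fact we only use `0 ≤ e(ρ)`. -/
theorem exp_offset_nonneg (η : ℝ) (ρ : Fin D → ℤ) : 0 ≤ Real.exp (η * ∑ i, |(ρ i : ℝ)|) := (Real.exp_pos _).le

/-- [folklore] ARITHMETIC CORE of the termwise bound: `‖E‖ ≤ e`, `‖S‖² ≤ (6M²)^D·P`, `‖s‖² ≤ 6M²`, `0 ≤ P`, `0 < M` ⇒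
`(‖E‖·‖S‖·‖s‖ / M^{D+1})² ≤ e²·6^{D+1}·P`. -/
theorem core_sq_le {E S s : ℂ} {e P : ℝ} {M : ℕ} (hM : 0 < M) (hE : ‖E‖ ≤ e) (hS : ‖S‖ ^ 2 ≤ (6 * (M : ℝ) ^ 2) ^ D * P)
    (hs : ‖s‖ ^ 2 ≤ 6 * (M : ℝ) ^ 2) (hP : 0 ≤ P) :
    (‖E‖ * ‖S‖ * ‖s‖ / (M : ℝ) ^ (D + 1)) ^ 2 ≤ e ^ 2 * ((6 : ℝ) ^ (D + 1) * P) := by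
  have hMr : (0 : ℝ) < M := by exact_mod_cast hM
  have hMpow : (0 : ℝ) < (M : ℝ) ^ (D + 1) := pow_pos hMr _
  have he : 0 ≤ e := (norm_nonneg E).trans hE
  have hE2 : ‖E‖ ^ 2 ≤ e ^ 2 := pow_le_pow_left₀ (norm_nonneg _) hE 2
  have hprod : ‖S‖ ^ 2 * ‖s‖ ^ 2 ≤ ((6 * (M : ℝ) ^ 2) ^ D * P) * (6 * (M : ℝ) ^ 2) :=
    mul_le_mul hS hs (sq_nonneg _) (mul_nonneg (by positivity) hP)
  have hkey : ‖E‖ ^ 2 * (‖S‖ ^ 2 * ‖s‖ ^ 2) ≤ e ^ 2 * (((6 * (M : ℝ) ^ 2) ^ D * P) * (6 * (M : ℝ) ^ 2)) :=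
    mul_le_mul hE2 hprod (mul_nonneg (sq_nonneg _) (sq_nonneg _)) (sq_nonneg _)
  have hid : e ^ 2 * (((6 * (M : ℝ) ^ 2) ^ D * P) * (6 * (M : ℝ) ^ 2)) = e ^ 2 * ((6 : ℝ) ^ (D + 1) * P) * ((M : ℝ) ^ (D + 1)) ^ 2 := by
    ring
  rw [div_pow, div_le_iff₀ (pow_pos hMpow 2)]
  calc (‖E‖ * ‖S‖ * ‖s‖) ^ 2 = ‖E‖ ^ 2 * (‖S‖ ^ 2 * ‖s‖ ^ 2) := by ring
    _ ≤ e ^ 2 * (((6 * (M : ℝ) ^ 2) ^ D * P) * (6 * (M : ℝ) ^ 2)) := hkey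
    _ = e ^ 2 * ((6 : ℝ) ^ (D + 1) * P) * ((M : ℝ) ^ (D + 1)) ^ 2 := hid

/-- [folklore] **READING WEIGHT ON THE STRIP, sinWt form**: `‖readW N M p m κ ρ‖² ≤ e(ρ)²·6^{D+1}·Π_i sinWt M x_i`
(`|Im p_i| ≤ η ≤ 1/4`, `0 < M ≤ N`; the direction factor `sinWt M x_κ ≤ 1` is dropped). -/
theorem norm_readW_sq_le_sinWt (him : ∀ i, |(p i).im| ≤ η) (hη : 0 ≤ η) (hη4 : η ≤ 1 / 4) {M : ℕ} (hM : 0 < M) (hMN : M ≤ N)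
    (m : TorusSite D N) (κ : Fin D) (ρ : Fin D → ℤ) :
    ‖readW N M p m κ ρ‖ ^ 2 ≤ Real.exp (η * ∑ i, |(ρ i : ℝ)|) ^ 2 * ((6 : ℝ) ^ (D + 1) * ∏ i, sinWt M (kfine N (reVec p) m i)) := by
  set P : ℝ := ∏ i, sinWt M (kfine N (reVec p) m i) with hPdef
  have hP : 0 ≤ P := Finset.prod_nonneg fun i _ => (sinWt_pos _ _).le
  have hE := norm_cexp_offset_le him hMN m ρ
  have hS := norm_SMAl_sq_le_strip him hη hη4 hMN m
  have hs : ‖sMAl N M p m κ‖ ^ 2 ≤ 6 * (M : ℝ) ^ 2 :=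
    (norm_sMAl_sq_le_strip him hη hη4 hMN m κ).trans (mul_le_of_le_one_right (by positivity) (sinWt_le_one _ _))
  have hnorm : ‖readW N M p m κ ρ‖ =
      ‖cexp (I * ∑ i, kAl N p m i * ((M : ℂ) * (ρ i : ℂ)))‖ * ‖SMAl N M p m‖ * ‖sMAl N M p m κ‖ / (M : ℝ) ^ (D + 1) := by
    unfold readW
    rw [norm_div, norm_mul, norm_mul, norm_pow, Complex.norm_natCast]
  rw [hnorm]
  exact core_sq_le hM hE hS hs hP

/-- [folklore] **READING WEIGHT ON THE STRIP, alias-majorant form**: `‖readW N M p m κ ρ‖² ≤ e(ρ)²·6^{D+1}·((N/M)²)^D·Π_i wMaj N (m i)`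
(`|Re p_i| ≤ π` in addition). -/
theorem norm_readW_sq_le_strip (him : ∀ i, |(p i).im| ≤ η) (hre : ∀ i, |(p i).re| ≤ π) (hη : 0 ≤ η) (hη4 : η ≤ 1 / 4)
    {M : ℕ} (hM : 0 < M) (hMN : M ≤ N) (m : TorusSite D N) (κ : Fin D) (ρ : Fin D → ℤ) :
    ‖readW N M p m κ ρ‖ ^ 2 ≤
      Real.exp (η * ∑ i, |(ρ i : ℝ)|) ^ 2 * ((6 : ℝ) ^ (D + 1) * ((((N : ℝ) / M) ^ 2) ^ D * ∏ i, wMaj N (m i))) := by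
  refine (norm_readW_sq_le_sinWt him hη hη4 hM hMN m κ ρ).trans ?_
  exact mul_le_mul_of_nonneg_left (mul_le_mul_of_nonneg_left (prod_sinWt_le_wMaj hre hM hMN m) (by positivity)) (sq_nonneg _)

/-- [folklore] **SOURCE WEIGHT ON THE STRIP, sinWt form**: `‖N^D · srcW N M p m κ ρ‖² ≤ e(ρ)²·6^{D+1}·Π_i sinWt M x_i` (the flat twins
`S♭_M, s♭_M` obey the same majorants; `sinWt` is even). -/
theorem norm_srcW_sq_le_sinWt (him : ∀ i, |(p i).im| ≤ η) (hη : 0 ≤ η) (hη4 : η ≤ 1 / 4) {M : ℕ} (hM : 0 < M) (hMN : M ≤ N)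
    (m : TorusSite D N) (κ : Fin D) (ρ : Fin D → ℤ) :
    ‖(N : ℂ) ^ D * srcW N M p m κ ρ‖ ^ 2 ≤ Real.exp (η * ∑ i, |(ρ i : ℝ)|) ^ 2 * ((6 : ℝ) ^ (D + 1) * ∏ i, sinWt M (kfine N (reVec p) m i)) := by
  set P : ℝ := ∏ i, sinWt M (kfine N (reVec p) m i) with hPdef
  have hP : 0 ≤ P := Finset.prod_nonneg fun i _ => (sinWt_pos _ _).le
  have hE := norm_cexp_neg_offset_le him hMN m ρ
  have hS := norm_SbMAl_sq_le_strip him hη hη4 hMN m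
  have hs : ‖sbMAl N M p m κ‖ ^ 2 ≤ 6 * (M : ℝ) ^ 2 :=
    (norm_sbMAl_sq_le_strip him hη hη4 hMN m κ).trans (mul_le_of_le_one_right (by positivity) (sinWt_le_one _ _))
  have hN : ((N : ℂ) ^ D) ≠ 0 := pow_ne_zero _ (Nat.cast_ne_zero.2 (NeZero.ne N))
  have hnorm : ‖(N : ℂ) ^ D * srcW N M p m κ ρ‖ =
      ‖cexp (-(I * ∑ i, kAl N p m i * ((M : ℂ) * (ρ i : ℂ))))‖ * ‖SbMAl N M p m‖ * ‖sbMAl N M p m κ‖ / (M : ℝ) ^ (D + 1) := by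
    unfold srcW
    rw [mul_div_cancel₀ _ hN, norm_div, norm_mul, norm_mul, norm_pow, Complex.norm_natCast]
  rw [hnorm]
  exact core_sq_le hM hE hS hs hP

/-- [folklore] **SOURCE WEIGHT ON THE STRIP, alias-majorant form**: `‖N^D · srcW N M p m κ ρ‖² ≤ e(ρ)²·6^{D+1}·((N/M)²)^D·Π_i wMaj N (m i)`. -/
theorem norm_srcW_sq_le_strip (him : ∀ i, |(p i).im| ≤ η) (hre : ∀ i, |(p i).re| ≤ π) (hη : 0 ≤ η) (hη4 : η ≤ 1 / 4)
    {M : ℕ} (hM : 0 < M) (hMN : M ≤ N) (m : TorusSite D N) (κ : Fin D) (ρ : Fin D → ℤ) :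
    ‖(N : ℂ) ^ D * srcW N M p m κ ρ‖ ^ 2 ≤
      Real.exp (η * ∑ i, |(ρ i : ℝ)|) ^ 2 * ((6 : ℝ) ^ (D + 1) * ((((N : ℝ) / M) ^ 2) ^ D * ∏ i, wMaj N (m i))) := by
  refine (norm_srcW_sq_le_sinWt him hη hη4 hM hMN m κ ρ).trans ?_
  exact mul_le_mul_of_nonneg_left (mul_le_mul_of_nonneg_left (prod_sinWt_le_wMaj hre hM hMN m) (by positivity)) (sq_nonneg _)

/-- [folklore] The un-multiplied source weight: `‖srcW N M p m κ ρ‖² ≤ e(ρ)²·6^{D+1}·((N/M)²)^D·Π_i wMaj N (m i) / (N^D)²`. -/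
theorem norm_srcW_sq_le_strip' (him : ∀ i, |(p i).im| ≤ η) (hre : ∀ i, |(p i).re| ≤ π) (hη : 0 ≤ η) (hη4 : η ≤ 1 / 4)
    {M : ℕ} (hM : 0 < M) (hMN : M ≤ N) (m : TorusSite D N) (κ : Fin D) (ρ : Fin D → ℤ) :
    ‖srcW N M p m κ ρ‖ ^ 2 ≤
      Real.exp (η * ∑ i, |(ρ i : ℝ)|) ^ 2 * ((6 : ℝ) ^ (D + 1) * ((((N : ℝ) / M) ^ 2) ^ D * ∏ i, wMaj N (m i))) / (((N : ℝ) ^ D) ^ 2) := by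
  have hN : (0 : ℝ) < (N : ℝ) ^ D := pow_pos (by exact_mod_cast Nat.pos_of_ne_zero (NeZero.ne N)) _
  have h := norm_srcW_sq_le_strip him hre hη hη4 hM hMN m κ ρ
  rw [norm_mul, norm_pow, Complex.norm_natCast, mul_pow] at h
  rw [le_div_iff₀ (pow_pos hN 2)]
  linarith [h]

end Termwise

/-! ## §2 Summed over the aliases -/

section Summed

variable {p : Fin D → ℂ} {η : ℝ}

/-- [folklore] The full box sum of the majorant products: `Σ_m Π_i wMaj N (m i) ≤ 5^D` (leaf-17's off-zero sum `≤ 5^D − 1` plus the zero term `1`). -/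
theorem sum_prod_wMaj_le_five_pow : ∑ m : TorusSite D N, ∏ i, wMaj N (m i) ≤ (5 : ℝ) ^ D := by
  classical
  have h := sum_prod_wMaj_le (D := D) N
  have h0 : ∏ i : Fin D, wMaj N ((0 : TorusSite D N) i) = 1 := by simp
  have hsplit := Finset.sum_erase_add (Finset.univ : Finset (TorusSite D N)) (fun m => ∏ i, wMaj N (m i)) (Finset.mem_univ 0)
  rw [← hsplit, h0]
  linarith

/-- [folklore] **THE READING `ℓ²`-SUM ON THE STRIP**: `Σ_m ‖readW N M p m κ ρ‖² ≤ e(ρ)²·6^{D+1}·((N/M)²)^D·5^D` — uniform in `N` at fixed `N/M`. -/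
theorem sum_norm_readW_sq_le_strip (him : ∀ i, |(p i).im| ≤ η) (hre : ∀ i, |(p i).re| ≤ π) (hη : 0 ≤ η) (hη4 : η ≤ 1 / 4)
    {M : ℕ} (hM : 0 < M) (hMN : M ≤ N) (κ : Fin D) (ρ : Fin D → ℤ) :
    ∑ m : TorusSite D N, ‖readW N M p m κ ρ‖ ^ 2 ≤
      Real.exp (η * ∑ i, |(ρ i : ℝ)|) ^ 2 * ((6 : ℝ) ^ (D + 1) * ((((N : ℝ) / M) ^ 2) ^ D * (5 : ℝ) ^ D)) := by
  calc ∑ m : TorusSite D N, ‖readW N M p m κ ρ‖ ^ 2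
      ≤ ∑ m : TorusSite D N, Real.exp (η * ∑ i, |(ρ i : ℝ)|) ^ 2 * ((6 : ℝ) ^ (D + 1) * ((((N : ℝ) / M) ^ 2) ^ D * ∏ i, wMaj N (m i))) :=
        Finset.sum_le_sum fun m _ => norm_readW_sq_le_strip him hre hη hη4 hM hMN m κ ρ
    _ = Real.exp (η * ∑ i, |(ρ i : ℝ)|) ^ 2 * ((6 : ℝ) ^ (D + 1) * ((((N : ℝ) / M) ^ 2) ^ D * ∑ m : TorusSite D N, ∏ i, wMaj N (m i))) := by
        rw [← Finset.mul_sum, ← Finset.mul_sum, ← Finset.mul_sum]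
    _ ≤ Real.exp (η * ∑ i, |(ρ i : ℝ)|) ^ 2 * ((6 : ℝ) ^ (D + 1) * ((((N : ℝ) / M) ^ 2) ^ D * (5 : ℝ) ^ D)) := by
        gcongr
        exact sum_prod_wMaj_le_five_pow

/-- [folklore] **THE ROW-WEIGHTED SOURCE `ℓ²`-SUM ON THE STRIP**: for row weights `w` with `0 ≤ w m ≤ W` off the zero alias,
`Σ_m (w m)²·‖N^D·srcW N M p m κ ρ‖² ≤ e(ρ)²·6^{D+1}·((N/M)²)^D·((w 0)² + W²·(5^D − 1))`.
(In the cut: `w m = N²/r_m²` on the EL rows, `r_m ≥ π` for `m ≠ 0`, so `W = N²/π²`; `w 0 = N²/r₀²`.) -/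
theorem sum_weighted_norm_srcW_sq_le_strip (him : ∀ i, |(p i).im| ≤ η) (hre : ∀ i, |(p i).re| ≤ π) (hη : 0 ≤ η) (hη4 : η ≤ 1 / 4)
    {M : ℕ} (hM : 0 < M) (hMN : M ≤ N) (κ : Fin D) (ρ : Fin D → ℤ) (w : TorusSite D N → ℝ) {W : ℝ}
    (hw : ∀ m, m ≠ 0 → 0 ≤ w m ∧ w m ≤ W) :
    ∑ m : TorusSite D N, w m ^ 2 * ‖(N : ℂ) ^ D * srcW N M p m κ ρ‖ ^ 2 ≤
      Real.exp (η * ∑ i, |(ρ i : ℝ)|) ^ 2 * ((6 : ℝ) ^ (D + 1) * (((N : ℝ) / M) ^ 2) ^ D) * (w 0 ^ 2 + W ^ 2 * ((5 : ℝ) ^ D - 1)) := by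
  classical
  set K : ℝ := Real.exp (η * ∑ i, |(ρ i : ℝ)|) ^ 2 * ((6 : ℝ) ^ (D + 1) * (((N : ℝ) / M) ^ 2) ^ D) with hK
  have hK0 : 0 ≤ K := by positivity
  -- termwise: w m² ‖·‖² ≤ K · w m² · Θ(m)
  have hterm : ∀ m : TorusSite D N, w m ^ 2 * ‖(N : ℂ) ^ D * srcW N M p m κ ρ‖ ^ 2 ≤ K * (w m ^ 2 * ∏ i, wMaj N (m i)) := by
    intro m
    have h := norm_srcW_sq_le_strip him hre hη hη4 hM hMN m κ ρ
    calc w m ^ 2 * ‖(N : ℂ) ^ D * srcW N M p m κ ρ‖ ^ 2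
        ≤ w m ^ 2 * (Real.exp (η * ∑ i, |(ρ i : ℝ)|) ^ 2 * ((6 : ℝ) ^ (D + 1) * ((((N : ℝ) / M) ^ 2) ^ D * ∏ i, wMaj N (m i)))) :=
          mul_le_mul_of_nonneg_left h (sq_nonneg _)
      _ = K * (w m ^ 2 * ∏ i, wMaj N (m i)) := by rw [hK]; ring
  -- split off the zero alias
  have hsplit := Finset.sum_erase_add (Finset.univ : Finset (TorusSite D N)) (fun m => w m ^ 2 * ∏ i, wMaj N (m i)) (Finset.mem_univ 0)
  have h0 : w 0 ^ 2 * ∏ i : Fin D, wMaj N ((0 : TorusSite D N) i) = w 0 ^ 2 := by simp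
  have hoff : ∑ m ∈ (Finset.univ : Finset (TorusSite D N)).erase 0, w m ^ 2 * ∏ i, wMaj N (m i) ≤ W ^ 2 * ((5 : ℝ) ^ D - 1) := by
    calc ∑ m ∈ (Finset.univ : Finset (TorusSite D N)).erase 0, w m ^ 2 * ∏ i, wMaj N (m i)
        ≤ ∑ m ∈ (Finset.univ : Finset (TorusSite D N)).erase 0, W ^ 2 * ∏ i, wMaj N (m i) := by
          refine Finset.sum_le_sum fun m hm => ?_
          have hm0 : m ≠ 0 := (Finset.mem_erase.1 hm).1
          exact mul_le_mul_of_nonneg_right (pow_le_pow_left₀ (hw m hm0).1 (hw m hm0).2 2) (prod_wMaj_nonneg m)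
      _ = W ^ 2 * ∑ m ∈ (Finset.univ : Finset (TorusSite D N)).erase 0, ∏ i, wMaj N (m i) := by rw [Finset.mul_sum]
      _ ≤ W ^ 2 * ((5 : ℝ) ^ D - 1) := mul_le_mul_of_nonneg_left (sum_prod_wMaj_le N) (sq_nonneg _)
  have hmaj : ∑ m : TorusSite D N, w m ^ 2 * ∏ i, wMaj N (m i) ≤ w 0 ^ 2 + W ^ 2 * ((5 : ℝ) ^ D - 1) := by
    rw [← hsplit, h0]
    linarith
  calc ∑ m : TorusSite D N, w m ^ 2 * ‖(N : ℂ) ^ D * srcW N M p m κ ρ‖ ^ 2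
      ≤ ∑ m : TorusSite D N, K * (w m ^ 2 * ∏ i, wMaj N (m i)) := Finset.sum_le_sum fun m _ => hterm m
    _ = K * ∑ m : TorusSite D N, w m ^ 2 * ∏ i, wMaj N (m i) := by rw [Finset.mul_sum]
    _ ≤ K * (w 0 ^ 2 + W ^ 2 * ((5 : ℝ) ^ D - 1)) := mul_le_mul_of_nonneg_left hmaj hK0

end Summed

end Summit.QuantumFields.BalabanUV.Beta.GAN24.StripLegVectors

end
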